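import Mathlib.Analysis.SpecialFunctions.Log.Basic
import Mathlib.Analysis.SpecialFunctions.Pow.Real
import Literature.IUT.LogVolume.Corollary23ChainUnconditional
import Literature.NumberTheory.DiophantineGeometry.GenEllThm21
import Literature.NumberTheory.EllipticCurves.SzpiroOfAbcProofs
import Summits.ABC.ABC.Statement
import HarnessLib

/-!
# [J-IV] §7 "Vojta's Inequality for `U_X(Q̄)_{≤d}`": Thm 7.1.1 with its proof (7.1.2)–(7.1.11), and §7.2 —
# TYPED over the tree's `λ`-line vocabulary, NOT asserted

Block E of the abc-iut cell (rung LADDER-ABC:A2.E), seat abc-iut-E-t33, slot T-33; nodes J4:Thm7.1.1, J4:Rmk7.1.12,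
J4:Thm7.2.1 of plan/E/JOSHI-DAG.tsv (+ proof-display rows, plan/E/t33/INVENTORY.tsv). SOURCE: K. Joshi, *Construction of
Arithmetic Teichmüller Spaces IV: Proof of the abc-conjecture*, arXiv:2403.10430**v2** (unrefereed, "Preliminary version";
bib `Joshi2024ATS4`), §7 = PDF pp. 72–75; «p.N l.a–b» = PDF page/lines of `HOME/lit/renders/Joshi-arxiv-2403.10430/`.
FRAMING (binding): this file TYPES a third party's unrefereed text; it takes NO side on [IUTchIII] Cor 3.12, on Joshi's
claims, or on Mochizuki's report on them, and makes NO abc claim: what Joshi ASSERTS is a `Prop`-valued `def` tagged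
`@[claim "Joshi2024ATS4" "disputed"]` (the registered status word recording that a dispute exists in print) — never an
axiom, instance, `sorry`, or Literature fact; every `theorem` is DERIVED bookkeeping (a printed step reduces exactly to
the NAMED printed inputs). Typed ≠ proved; typed AS A CANDIDATE ≠ endorsed.

WHAT §7 IS. Thm 7.1.1 (p.72 l.65–69, "the main theorem of this paper") = Vojta's height inequality on `U_X(Q̄)_{≤d}` for
every hyperbolic curve = the display of Conj 2.5.1 / Thm 2.10.1 (slot T-24, `Joshi/ATS4Statements.lean`; [J-IV] p.10:
= his [IUTchIV] Cor 2.3). Its PROOF (pp.73–75) runs on the `λ`-line `U = ℙ¹ − {0,1,∞}` (§5.5) after the reduction "By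
the main theorem of [Mochizuki, 2010]" (= [GenEll] Thm 2.1) and consumes Thm 5.7.1 ("my formulation of [IUTchIV] Cor
2.2", T-28), Prop 5.6.1 (T-28), Lem 5.8.7 (T-29), Thm 6.1.1 (= [IUTchIV] Thm 1.10 with `η_prm = 60`, T-30; rests on
Cor 3.12), then elementary real algebra (7.1.2)–(7.1.11). INTERIM CARRIER RULE (plan/E/ASSIGNMENTS §0.3): those inputs
enter ONLY as the per-point inequalities §7.1 CONSUMES (fields of `PointInputs` / `Thm711Inputs`, with locators;
merge-debt: a reconciliation seat maps T-28/29/30's landed decls onto them). R14: no `Cor312*`/`Thm311*` import. The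
general-curve display, Thm 7.2.1 AS PRINTED ("Conjecture 2.1.1 and the arithmetic Szpiro conjecture", T-24's names)
and Rmk 7.1.12 go to the companion `Joshi/ATS4VojtaBoundedDegreeAbc.lean`; here §7.2 is proved over tree names.
DICTIONARY (OUR side = the tree's typing of [IUTchIV] §2 over [GenEll], BY NAME): `Tate = Q` (Def 5.4.1) ↦
`Cor22.logQForall`, `Tate₂ = Q₂` ↦ `Cor22.logQNotTwo` (Rmk 5.4.3's own table `q^∀ ↔ Tate`, `q^{∤2} ↔ Tate₂`); `log(q)`
of Thm 6.1.1 (Tate divisor at `𝕍^{odd,ss}`, `∤ 2ℓ`) ↦ `Cor22.logQAvoid P {2, ℓ}`; `h_{ω_{ℙ¹}(D)}` ↦ `NFPoint.ht`; `h_∞` ↦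
`Cor22.htInfty`; `log-diff(x_λ) = log(𝔡^{L_tpd})`, `log-con_D(x_λ) = log(𝔣^{L_tpd})` (p.75 l.18) ↦ `NFPoint.logDiff` /
`logCond`; `Z(Z, S)` ↦ `GenEll.CBData`; `U(Q̄)_{≤d}` ↦ `UPle d`; (5.6.2) with `{2,∞} ⊆ S` ↦ `Cor22.Hypotheses`; `δ` ↦
`Cor22.delta d`; `≲`/`≈` ↦ `BDLe`/`BDEquiv`; Prop 5.6.1's chain "(1/6)·Tate₂ ≈ (1/6)·Tate ≈ (1/6)·h_∞ ≈ h_{ω_{ℙ¹}(D)}"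
(p.53 l.8–11) IS, term for term, [IUTchIV] Cor 2.2 (i) = `Cor22.PartI D`.
FAITHFULNESS FLAGS (ref-x lane; no side taken): (F1) `δ` is printed per curve, `2^12·3^3·5·d_mod` (p.53 l.35–36);
typed with the uniform `Cor22.delta d ≥` it (`d_mod ≤ d`) — every §7.1 use of `δ` is an UPPER bound, so hypotheses only
weaken. (F2) Thm 5.7.1 prints `ℓ ≤ 10·δ·Q^{1/2}·log(2·δ·log(Q))` (p.53 l.43); Lem 5.8.7 (1)/§7.1 use `log(2·δ·Q)` (p.56
l.36, p.73 l.64) — typed as USED. (F3) (7.1.3) carries `(15·δ)²` but (7.1.4)/(7.1.5) rewrite the same term with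
`6·(15·δ²)` (`90δ² < 200δ²` of p.73 l.64): a constant slip, immaterial; `α_λ` is typed with a generic `κ`, instantiated at
`(15δ)²`. (F4) the three "Q is bounded ⟹ finitely many curves ⟹ enlarge Exc" moves (p.74 l.20–24, l.67–77, p.75
l.1–3) are discharged as ONE threshold lemma; in BD-class form no finiteness/Northcott step is needed (a bounded-`Q`
point satisfies (7.1.9) since `log-diff + log-con ≥ 0`). (F5) "finite set `Exc`": only the printed height bound on `Exc`
(p.73 l.10–11) is used.
-/

noncomputable section

namespace Summit.ABC.IUTFork.Joshi.ATS4

open Literature.NumberTheory.DiophantineGeometry Literature.NumberTheory.DiophantineGeometry.GenEll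
open Literature.IUT.LogVolume Literature.IUT.LogVolume.Cor22

/-! ## 1. Theorem 7.1.1 in the form its proof establishes (p.73 l.1–8), and the `ℙ¹` reduction -/

/-- **[J-IV] Thm 7.1.1, reduced form** (p.72 l.65–69 with p.73 l.1–8, verbatim): "Theorem 7.1.1. Let `X` be a
geometrically connected, smooth, projective curve over a number field `L`. Let `D ⊂ X` be a reduced divisor, let
`U_X = X − D`. Assume `U_X` is a hyperbolic curve. Let `d ∈ ℕ`. Let `ε > 0`. Then one has the inequality
`h_{ω_X(D)} ≲ (1 + ε)(log-diff_X + log-con_D)` holds on `U_X(Q̄)_{≤d}`. *Proof.* By the main theorem of [Mochizuki,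
2010], proving this assertion is equivalent to proving this assertion for `X = ℙ¹_ℚ`, `D = {0, 1, ∞}` for compactly
bounded subsets of `U_{ℙ¹}(Q̄)_{≤d}` satisfying the 2-adic `j`-invariant condition (5.6.2). Then it suffices to prove
that `h_{ω_{ℙ¹}(D)} ≲ (1+ε)(log-diff_{ℙ¹} + log-con_D)` holds on `Z ∩ U_{ℙ¹}(Q̄)_{≤d}`." THIS `def` = the last sentence,
for every `Z` with `{2,∞} ⊆ S` and (5.6.2) (= `Cor22.Hypotheses`), `d ≥ 1`, `ε > 0`; the general-curve display is
T-24's `MainTheorem` (companion file). CLAIM of an unrefereed preprint; NOT asserted; no abc claim. -/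
@[claim "Joshi2024ATS4" "disputed"]
def Thm711Reduced : Prop :=
  ∀ D : CBData, Cor22.Hypotheses D → ∀ d : ℕ, 0 < d → ∀ ε : ℝ, 0 < ε → VojtaIneq D.toSet d ε

/-- The trivial half of "equivalent" (p.73 l.1–5): Thm 7.1.1 for `(ℙ¹_ℚ, {0,1,∞})` — i.e. `VojtaP1Deg d` for all
`d ≥ 1` — restricts to every `Z ∩ U(Q̄)_{≤d}`. PROVED. [folklore] -/
theorem thm711Reduced_of_vojtaP1Deg (h : ∀ d : ℕ, 0 < d → VojtaP1Deg d) : Thm711Reduced :=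
  fun _ _ d hd ε hε => (h d hd ε hε).mono (Set.inter_subset_inter_left _ (Set.subset_univ _))

/-- **The `ℙ¹` half of "By the main theorem of [Mochizuki, 2010] … equivalent"** (p.73 l.1–5), PROVED: the reduced
form gives [GenEll] Thm 2.1 (ii) for `Σ = {2}` (WLOG (5.6.2) = tree theorem `Cor22.jInvVacuous_holds`), hence
(i)|_{ℙ¹} = `VojtaP1Deg d`, `d ≥ 1`, by the tree theorem `GenEll_thm21_primes_holds`. (The general-curve half is
[GenEll] (ii) ⟹ (i) for ALL hyperbolic curves: `TODO(general form)` in `GenEllThm21.lean`.) [folklore] -/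
theorem vojtaP1Deg_of_thm711Reduced (h : Thm711Reduced) {d : ℕ} (hd : 0 < d) : VojtaP1Deg d := by
  have hcb : ABCCompactlyBounded ({2} : Finset ℕ) := by
    intro d' hd' ε hε D hD
    obtain ⟨D', hD', hsub⟩ := jInvVacuous_holds D hD d' hd'
    exact (h D' hD' d' hd' ε hε).mono fun P hP => ⟨hsub hP, hP.2⟩
  exact vojtaP1Deg_of_abcCompactlyBounded_two_primes GenEll_thm21_primes_holds hcb hd

/-! ## 2. The inputs §7.1 consumes at a point `x_λ ∈ Z ∩ U(Q̄)_{≤d} ∖ Exc` (interim carrier; merge-debt T-28/29/30) -/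

/-- **The per-point inputs of §7.1** at `x_λ ∉ Exc` with its prime `ℓ` and the degrees `d_mod = [L_mod : ℚ]`, `e*_mod`
(reals), EXACTLY as pp.73–74 consume them (HYPOTHESES asserted in print by the cited results; never asserted here):
`0 ≤ e*_mod ≤ d_mod` (p.73 l.33–34), `d_mod ≤ d` (`L_mod = ℚ(j_λ) ⊆ ℚ(λ)`); `Q^{1/2} ≥ 5` (p.54 l.27–28, premise of Lem
5.8.7); Lem 5.8.7 (1): "`Q^{1/2} ≤ ℓ ≤ 10·δ·Q^{1/2}·log(2·δ·Q)`" (p.56 l.35–36; FLAG F2); Thm 6.1.1, first inequality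
(p.58 l.4–16, invoked p.73 l.13–25): "`(1/6)·log(q) ≤ (1 + 20·d_mod/ℓ)·(log(𝔡^{L_tpd}) + log(𝔣^{L_tpd})) + 20(e*_mod·ℓ
+ 60)`"; (7.1.2), first inequality (p.73 l.65–74, "by … Lemma 5.8.7"): "`(1/6)·Q₂ − (1/6)·q ≤ (1/6)·Q^{1/2}·log(ℓ)`"
(`q` there = `log(q)`). [claim: Joshi2024ATS4, status: disputed] -/
structure PointInputs (d : ℕ) (P : NFPoint) (ℓ : ℕ) (dmod emod : ℝ) : Prop where
  /-- `0 ≤ e*_mod`. -/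
  emod_nonneg : 0 ≤ emod
  /-- `e*_mod ≤ d_mod` (p.73 l.33–34). -/
  emod_le_dmod : emod ≤ dmod
  /-- `d_mod ≤ d` on `U(Q̄)_{≤d}`. -/
  dmod_le : dmod ≤ d
  /-- `Q^{1/2} ≥ ξ_prm ≥ 5` off `Exc` (p.54 l.27–28). -/
  five_le_sqrt : 5 ≤ Real.sqrt (logQForall P)
  /-- Lem 5.8.7 (1), lower: `Q^{1/2} ≤ ℓ`. -/
  sqrt_le_ell : Real.sqrt (logQForall P) ≤ ℓ
  /-- Lem 5.8.7 (1), upper, as used p.73 l.64: `ℓ ≤ 10·δ·Q^{1/2}·log(2·δ·Q)`. -/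
  ell_le : (ℓ : ℝ) ≤ 10 * delta d * Real.sqrt (logQForall P) * Real.log (2 * delta d * logQForall P)
  /-- Thm 6.1.1, first inequality, for `C_λ` (p.58 l.4–16). -/
  thm611 : 1 / 6 * logQAvoid P {2, ℓ} ≤
    (1 + 20 * dmod / ℓ) * (P.logDiff + P.logCond) + 20 * (emod * ℓ + 60)
  /-- (7.1.2), first inequality (from Lem 5.8.7 (3)). -/
  eq712 : 1 / 6 * logQNotTwo P - 1 / 6 * logQAvoid P {2, ℓ} ≤
    1 / 6 * Real.sqrt (logQForall P) * Real.log ℓ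

/-- **What §7.1 takes from Thm 5.7.1 and Prop 5.6.1 for a given `Z` and `d`** (p.73 l.9–13, verbatim): "Consider an
elliptic curve `C_λ` given by Theorem 5.7.1 and let `Exc` be the set constructed in the proof of Theorem 5.7.1. This
curve satisfies all the conditions of Theorem 6.1.1 and the set for `x_λ ∈ Exc`, the height is bounded by some
constant depending on `d`, `Z`. … For `C_λ ∉ Exc`, the estimate provided by Theorem 6.1.1 holds." Prop 5.6.1 =
`Cor22.PartI D` BY NAME (used p.73 l.75–79, p.75 l.11–12). Interim carrier. [claim: Joshi2024ATS4, status: disputed] -/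
structure Thm711Inputs (D : CBData) (d : ℕ) where
  /-- `Exc = Exc(Z, d) ⊂ U(Q̄)_{≤d}` of Thm 5.7.1, as enlarged in §7.1 (p.73 l.9–13). -/
  Exc : Set NFPoint
  /-- "for `x_λ ∈ Exc`, the height is bounded by some constant depending on `d`, `Z`" (p.73 l.10–11). -/
  ht_bdd_on_exc : ∃ H : ℝ, ∀ P ∈ Exc, P.ht ≤ H
  /-- off `Exc`: the prime `ℓ` of Thm 5.7.1 and the inputs `PointInputs` (p.73 l.13 ff). -/
  offExc : ∀ P ∈ D.toSet ∩ UPle d, P ∉ Exc →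
    ∃ (ℓ : ℕ) (dmod emod : ℝ), ℓ.Prime ∧ PointInputs d P ℓ dmod emod
  /-- Prop 5.6.1 (p.53 l.2–11) = [IUTchIV] Cor 2.2 (i), the tree's `Cor22.PartI`. -/
  prop561 : PartI D

/-- `δ ≥ 1` for `d ≥ 1` (`δ = 2^12·3^3·5·d`). [folklore] -/
theorem one_le_delta {d : ℕ} (hd : 0 < d) : (1 : ℝ) ≤ delta d := by
  have : (1 : ℝ) ≤ d := by exact_mod_cast hd
  unfold delta; nlinarith

/-! ## 3. The elementary chain (7.1.2)–(7.1.9) (pp.73–75), PROVED over the reals -/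

namespace Thm711

/-- **(7.1.5)** (p.74 l.17–19): "`α_λ = 6·(15·δ²)·log(2·δ·Q)/Q^{1/2}`", with a generic constant `κ` in place of the
printed `15·δ²` (FLAG F3; instantiated at `κ = (15δ)²` below). [claim: Joshi2024ATS4, status: disputed] -/
def alpha (κ δ Q : ℝ) : ℝ := 6 * κ * Real.log (2 * δ * Q) / Real.sqrt Q

/-- `log t ≤ t/K + log K` for `t, K > 0` (from `log x ≤ x − 1`). [folklore] -/
theorem log_le_div_add_log {t K : ℝ} (ht : 0 < t) (hK : 0 < K) : Real.log t ≤ t / K + Real.log K := by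
  have h := Real.log_le_sub_one_of_pos (div_pos ht hK)
  rw [Real.log_div ht.ne' hK.ne'] at h; linarith

/-- **The growth fact behind every "Q is bounded" sentence of §7.1** (p.74 l.20–24, l.67–72; p.75 l.1–3), in
`t = Q^{1/2}`: for `δ, κ, η > 0` there is `t₀ > 0` with `δ/t ≤ η` and `κ·log(2δt²) ≤ η·t` for `t ≥ t₀`. [folklore] -/
theorem exists_threshold_sqrt {δ κ η : ℝ} (hδ : 0 < δ) (hκ : 0 < κ) (hη : 0 < η) :
    ∃ t₀ : ℝ, 0 < t₀ ∧ ∀ t : ℝ, t₀ ≤ t → δ / t ≤ η ∧ κ * Real.log (2 * δ * t ^ 2) ≤ η * t := by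
  set K : ℝ := 4 * κ / η with hK
  have hKpos : 0 < K := by positivity
  set c : ℝ := κ * Real.log (2 * δ) + 2 * κ * Real.log K with hc
  refine ⟨max (δ / η) (max 1 (2 / η * |c|)), lt_max_of_lt_left (div_pos hδ hη), fun t ht => ?_⟩
  have h1 : δ / η ≤ t := (le_max_left _ _).trans ht
  have h2 : 1 ≤ t := ((le_max_left _ _).trans (le_max_right _ _)).trans ht
  have h3 : 2 / η * |c| ≤ t := ((le_max_right _ _).trans (le_max_right _ _)).trans ht
  have htpos : 0 < t := by linarith
  refine ⟨?_, ?_⟩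
  · rw [div_le_iff₀ htpos]; rw [div_le_iff₀ hη] at h1; linarith [mul_comm η t]
  · have hlog : Real.log (2 * δ * t ^ 2) = Real.log (2 * δ) + 2 * Real.log t := by
      rw [Real.log_mul (by positivity) (by positivity), Real.log_pow]; push_cast; ring
    have hlt := log_le_div_add_log htpos hKpos
    have hcK : 2 * κ * (t / K) = η / 2 * t := by rw [hK]; field_simp; ring
    have hct : |c| ≤ η / 2 * t :=
      calc |c| = η / 2 * (2 / η * |c|) := by field_simp
        _ ≤ η / 2 * t := mul_le_mul_of_nonneg_left h3 (by positivity)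
    calc κ * Real.log (2 * δ * t ^ 2) = κ * Real.log (2 * δ) + 2 * κ * Real.log t := by rw [hlog]; ring
      _ ≤ κ * Real.log (2 * δ) + 2 * κ * (t / K + Real.log K) := by gcongr
      _ = c + η / 2 * t := by rw [hc, mul_add, hcK]; ring
      _ ≤ η * t := by linarith [le_abs_self c]

/-- **The three WLOG moves of §7.1 as ONE threshold** (p.74 l.20–24 "if `1 ≤ α_λ` then … `Q` is bounded … one may
assume `α_λ < 1`"; p.74 l.67–77 "`(1+δ·Q^{−1/2})/(1−α_λ) > 1+ε` … implies that `Q` is bounded … assume `< 1+ε`"; p.75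
l.1–3 "`(1−α_λ)^{−1} > 2` leads to `α_λ > 1/2` … assume `(1−α_λ)^{−1} ≤ 2`"): beyond some `B`, `α_λ ≤ 1/2` and
`(1 + δ/Q^{1/2})/(1 − α_λ) ≤ 1 + ε`. PROVED. [folklore] -/
theorem exists_wlog_threshold {δ κ ε : ℝ} (hδ : 0 < δ) (hκ : 0 < κ) (hε : 0 < ε) :
    ∃ B : ℝ, 0 ≤ B ∧ ∀ Q : ℝ, B < Q →
      alpha κ δ Q ≤ 1 / 2 ∧ (1 + δ / Real.sqrt Q) / (1 - alpha κ δ Q) ≤ 1 + ε := by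
  set η : ℝ := min (1 / 2) (ε / (2 + ε)) with hηdef
  have hη : 0 < η := lt_min (by norm_num) (by positivity)
  have hη2 : η ≤ 1 / 2 := min_le_left _ _
  have hηε : η ≤ ε / (2 + ε) := min_le_right _ _
  obtain ⟨t₀, ht₀, h⟩ := exists_threshold_sqrt hδ hκ (by positivity : 0 < η / 6)
  refine ⟨t₀ ^ 2, sq_nonneg _, fun Q hQ => ?_⟩
  have hQpos : 0 < Q := (sq_nonneg _).trans_lt hQ
  have ht : t₀ ≤ Real.sqrt Q := by rw [← Real.sqrt_sq ht₀.le]; exact Real.sqrt_le_sqrt hQ.le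
  have hspos : 0 < Real.sqrt Q := ht₀.trans_le ht
  obtain ⟨h1, h2⟩ := h _ ht
  rw [Real.sq_sqrt hQpos.le] at h2
  have hα : alpha κ δ Q ≤ η := by unfold alpha; rw [div_le_iff₀ hspos]; linarith
  refine ⟨hα.trans hη2, ?_⟩
  have hδs : δ / Real.sqrt Q ≤ η := h1.trans (by linarith)
  have hden : 0 < 1 - alpha κ δ Q := by linarith
  rw [div_le_iff₀ hden]
  have hηε' : η * (2 + ε) ≤ ε := by rwa [le_div_iff₀ (by positivity)] at hηε
  calc 1 + δ / Real.sqrt Q ≤ 1 + η := by linarith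
    _ ≤ (1 + ε) * (1 - η) := by nlinarith
    _ ≤ (1 + ε) * (1 - alpha κ δ Q) := mul_le_mul_of_nonneg_left (by linarith) (by linarith)

/-- Contrapositive, as print phrases it: if a WLOG condition fails at `x_λ` ("`1 ≤ α_λ`", "`> 1 + ε`", "`α_λ > 1/2`"),
then "`Q` is bounded" by a constant depending only on `δ, κ, ε` (p.74 l.20–24, l.71–72; p.75 l.1–3). [folklore] -/
theorem Q_le_of_wlog_fails {δ κ ε : ℝ} (hδ : 0 < δ) (hκ : 0 < κ) (hε : 0 < ε) :
    ∃ B : ℝ, ∀ Q : ℝ, (1 / 2 < alpha κ δ Q ∨ 1 + ε < (1 + δ / Real.sqrt Q) / (1 - alpha κ δ Q)) → Q ≤ B := by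
  obtain ⟨B, -, hB⟩ := exists_wlog_threshold hδ hκ hε
  refine ⟨B, fun Q hQ => le_of_not_gt fun hlt => ?_⟩
  obtain ⟨h1, h2⟩ := hB Q hlt
  rcases hQ with hQ | hQ <;> linarith

/-- **(7.1.4)** (p.74 l.1–16): the term `κ·Q^{1/2}·log(2δQ)` of (7.1.3) rewritten as `(1/6)·Q·α_λ`. [folklore] -/
theorem ineq714_term {κ δ Q : ℝ} :
    κ * Real.sqrt Q * Real.log (2 * δ * Q) = 1 / 6 * Q * alpha κ δ Q := by
  unfold alpha
  rw [show 1 / 6 * Q * (6 * κ * Real.log (2 * δ * Q) / Real.sqrt Q)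
      = κ * Real.log (2 * δ * Q) * (Q / Real.sqrt Q) by ring, Real.div_sqrt]
  ring

/-- **(7.1.6) ⟺ (7.1.7)** (p.74 l.25–51, "equivalently"): `(1/6)Q ≤ X + (1/6)Q·α_λ + (1/2)A_Z` iff
`(1 − α_λ)·(1/6)Q ≤ X + (1/2)A_Z`. [folklore] -/
theorem ineq716_iff_717 {Q X α C : ℝ} :
    1 / 6 * Q ≤ X + 1 / 6 * Q * α + C ↔ (1 - α) * (1 / 6 * Q) ≤ X + C := by
  rw [show (1 - α) * (1 / 6 * Q) = 1 / 6 * Q - 1 / 6 * Q * α by ring]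
  constructor <;> intro h <;> linarith

/-- **(7.1.7) ⟹ (7.1.8)** (p.74 l.52–63, "dividing both the sides by `(1 − α_λ)`", `α_λ < 1`). [folklore] -/
theorem ineq718_of_717 {Q X α C : ℝ} (hα : α < 1) (h : (1 - α) * (1 / 6 * Q) ≤ X + C) :
    1 / 6 * Q ≤ (1 - α)⁻¹ * X + (1 - α)⁻¹ * C := by
  have hpos : 0 < 1 - α := by linarith
  calc 1 / 6 * Q = (1 - α)⁻¹ * ((1 - α) * (1 / 6 * Q)) := by
        rw [← mul_assoc, inv_mul_cancel₀ hpos.ne', one_mul]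
    _ ≤ (1 - α)⁻¹ * (X + C) := mul_le_mul_of_nonneg_left h (inv_nonneg.mpr hpos.le)
    _ = (1 - α)⁻¹ * X + (1 - α)⁻¹ * C := by ring

/-- **(7.1.8) + the two WLOG bounds ⟹ (7.1.9)** (p.75 l.4–10, "using both these inequalities one obtains
`(1/6)·Q ≤ (1+ε)·(log(𝔡^{L_tpd}) + log(𝔣^{L_tpd})) + A_Z`"), with `X = (1 + δQ^{−1/2})·(log 𝔡 + log 𝔣) ≥ 0` and
`C = A_Z/2 ≥ 0` (so `(1−α)^{−1}·C ≤ 2C = A_Z`). [folklore] -/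
theorem ineq719_of_718 {Q LD s α C ε : ℝ} (hLD : 0 ≤ LD) (hC : 0 ≤ C)
    (h : 1 / 6 * Q ≤ (1 - α)⁻¹ * ((1 + s) * LD) + (1 - α)⁻¹ * C)
    (h1 : (1 + s) / (1 - α) ≤ 1 + ε) (h2 : (1 - α)⁻¹ ≤ 2) :
    1 / 6 * Q ≤ (1 + ε) * LD + 2 * C := by
  rw [show (1 - α)⁻¹ * ((1 + s) * LD) = (1 + s) / (1 - α) * LD by ring] at h
  nlinarith [mul_le_mul_of_nonneg_right h1 hLD, mul_le_mul_of_nonneg_right h2 hC]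

/-- **(7.1.3) ⟹ (7.1.9) UNIFORMLY** (pp.74–75: the chain (7.1.4)–(7.1.9) beyond the WLOG threshold; the three "`Q` is
bounded ⟹ enlarge `Exc`" moves below it, FLAG F4): for `δ, κ, ε > 0` and any `C` there is `A` with `(1/6)Q ≤
(1 + δ/Q^{1/2})·LD + κ·Q^{1/2}·log(2δQ) + C ⟹ (1/6)Q ≤ (1+ε)·LD + A` for ALL `Q, LD ≥ 0`. PROVED. [folklore] -/
theorem ineq719_uniform {δ κ ε : ℝ} (hδ : 0 < δ) (hκ : 0 < κ) (hε : 0 < ε) (C : ℝ) :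
    ∃ A : ℝ, ∀ Q LD : ℝ, 0 ≤ Q → 0 ≤ LD →
      1 / 6 * Q ≤ (1 + δ / Real.sqrt Q) * LD + κ * Real.sqrt Q * Real.log (2 * δ * Q) + C →
      1 / 6 * Q ≤ (1 + ε) * LD + A := by
  obtain ⟨B, hB0, hB⟩ := exists_wlog_threshold hδ hκ hε
  refine ⟨2 * |C| + 1 / 6 * B, fun Q LD hQ hLD h => ?_⟩
  by_cases hQB : Q ≤ B
  · nlinarith [abs_nonneg C, mul_nonneg hε.le hLD]
  · obtain ⟨hα, hq⟩ := hB Q (lt_of_not_ge hQB)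
    have hα1 : alpha κ δ Q < 1 := by linarith
    have h' : 1 / 6 * Q ≤ (1 + δ / Real.sqrt Q) * LD + 1 / 6 * Q * alpha κ δ Q + |C| := by
      rw [← ineq714_term]; linarith [le_abs_self C]
    have h8 := ineq718_of_717 hα1 (ineq716_iff_717.mp h')
    have h2 : (1 - alpha κ δ Q)⁻¹ ≤ 2 :=
      (inv_le_comm₀ (by linarith) two_pos).mpr (by norm_num; linarith)
    have := ineq719_of_718 hLD (abs_nonneg C) h8 hq h2
    linarith

/-- **p.73 l.33–93: from Thm 6.1.1, `ℓ ≥ Q^{1/2}`, `e*_mod ≤ d_mod ≤ δ`, `η_prm = 60`, Lem 5.8.7, (7.1.2), Prop 5.6.1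
to (7.1.3)** "`(1/6)·Q ≤ (1 + δ/Q^{1/2})·(log(𝔡^{L_tpd}) + log(𝔣^{L_tpd})) + (15·δ)²·Q^{1/2}·log(2·δ·Q) + (1/2)·A_Z`"
("a new `Z`-dependent constant denoted again by `A_Z`": here `(1/2)·A_Z^{new} = 1200 + A_Z`), over reals, `sq = Q^{1/2}`;
the displays p.73 l.36–64 (`200·δ²`, `20·60`) and (7.1.2)'s right half (via `ℓ ≤ (2δQ)³`) are checked on the way.
PROVED. [folklore] -/
theorem ineq713 {Q Q₂ lq LD sq ℓ dmod emod δ A : ℝ}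
    (hsq : sq * sq = Q) (h5 : 5 ≤ sq) (hδ1 : 1 ≤ δ) (hdm : 20 * dmod ≤ δ) (hemδ : emod ≤ δ) (hLD : 0 ≤ LD)
    (hℓ1 : sq ≤ ℓ) (hℓ2 : ℓ ≤ 10 * δ * sq * Real.log (2 * δ * Q))
    (h611 : 1 / 6 * lq ≤ (1 + 20 * dmod / ℓ) * LD + 20 * (emod * ℓ + 60))
    (h712 : 1 / 6 * Q₂ - 1 / 6 * lq ≤ 1 / 6 * sq * Real.log ℓ)
    (h561 : 1 / 6 * Q - 1 / 6 * Q₂ ≤ A) :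
    1 / 6 * Q ≤ (1 + δ / sq) * LD + (15 * δ) ^ 2 * sq * Real.log (2 * δ * Q) + (1200 + A) := by
  set LM := Real.log (2 * δ * Q) with hLM
  have hsqpos : 0 < sq := by linarith
  have hQ25 : 25 ≤ Q := by nlinarith
  have hℓpos : 0 < ℓ := by linarith
  have hM1 : 1 ≤ 2 * δ * Q := by nlinarith
  have hlogM : 0 ≤ LM := Real.log_nonneg hM1
  have hsl : 0 ≤ sq * LM := mul_nonneg hsqpos.le hlogM
  -- `(1 + 20·d_mod/ℓ)·LD ≤ (1 + δ/Q^{1/2})·LD`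
  have s1 : 20 * dmod / ℓ ≤ δ / sq := by
    rw [div_le_div_iff₀ hℓpos hsqpos]
    calc 20 * dmod * sq ≤ δ * sq := mul_le_mul_of_nonneg_right hdm hsqpos.le
      _ ≤ δ * ℓ := mul_le_mul_of_nonneg_left hℓ1 (by linarith)
  have p1 : (1 + 20 * dmod / ℓ) * LD ≤ (1 + δ / sq) * LD := mul_le_mul_of_nonneg_right (by linarith) hLD
  -- `20·e*_mod·ℓ ≤ 200·δ²·Q^{1/2}·log(2δQ)`
  have s2 : emod * ℓ ≤ δ * (10 * δ * sq * LM) := mul_le_mul hemδ hℓ2 hℓpos.le (by linarith)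
  have p2 : 20 * (emod * ℓ) ≤ 200 * δ ^ 2 * sq * LM := by
    calc 20 * (emod * ℓ) ≤ 20 * (δ * (10 * δ * sq * LM)) := by linarith
      _ = 200 * δ ^ 2 * sq * LM := by ring
  -- (7.1.2), right half: `(1/6)·Q^{1/2}·log ℓ ≤ Q^{1/2}·log(2δQ)`
  have hℓM : ℓ ≤ (2 * δ * Q) ^ 3 := by
    have a1 : 10 * δ ≤ 2 * δ * Q := by nlinarith
    have a2 : sq ≤ 2 * δ * Q := by nlinarith
    have a3 : LM ≤ 2 * δ * Q := (Real.log_le_sub_one_of_pos (by linarith)).trans (by linarith)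
    calc ℓ ≤ 10 * δ * sq * LM := hℓ2
      _ ≤ 2 * δ * Q * (2 * δ * Q) * (2 * δ * Q) :=
          mul_le_mul (mul_le_mul a1 a2 hsqpos.le (by linarith)) a3 hlogM (by positivity)
      _ = (2 * δ * Q) ^ 3 := by ring
  have hlogℓ : Real.log ℓ ≤ 3 * LM := by
    have := Real.log_le_log hℓpos hℓM
    rw [Real.log_pow] at this; push_cast at this; linarith
  have p3 : 1 / 6 * sq * Real.log ℓ ≤ sq * LM := by
    have := mul_le_mul_of_nonneg_left hlogℓ (by linarith : 0 ≤ 1 / 6 * sq)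
    nlinarith
  -- `(200δ² + 1)·Q^{1/2}·log(2δQ) ≤ (15δ)²·Q^{1/2}·log(2δQ)` (`δ ≥ 1`)
  have hd2 : 1 ≤ δ ^ 2 := by nlinarith
  have key : 0 ≤ (25 * δ ^ 2 - 1) * (sq * LM) := mul_nonneg (by linarith) hsl
  have p4 : 200 * δ ^ 2 * sq * LM + sq * LM ≤ (15 * δ) ^ 2 * sq * LM := by
    rw [show (15 * δ) ^ 2 * sq * LM = 200 * δ ^ 2 * sq * LM + sq * LM + (25 * δ ^ 2 - 1) * (sq * LM) by ring]
    linarith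
  linarith [h561, h712, h611, p1, p2, p3, p4]

end Thm711

/-! ## 4. Assembly: the inputs give (7.1.3) at each point off `Exc`, hence (7.1.9)–(7.1.11), i.e. Thm 7.1.1 (reduced) -/

/-- (7.1.3) at a point `x_λ ∉ Exc` from its `PointInputs` and the Prop 5.6.1 constant `A_Z` (p.73 l.33–93), with
`κ = (15δ)²`. PROVED. [folklore] -/
theorem PointInputs.ineq713 {d : ℕ} {P : NFPoint} {ℓ : ℕ} {dmod emod : ℝ} (h : PointInputs d P ℓ dmod emod)
    (hd : 0 < d) {A : ℝ} (hA : 1 / 6 * logQForall P - 1 / 6 * logQNotTwo P ≤ A) :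
    1 / 6 * logQForall P ≤ (1 + delta d / Real.sqrt (logQForall P)) * (P.logDiff + P.logCond)
      + (15 * delta d) ^ 2 * Real.sqrt (logQForall P) * Real.log (2 * delta d * logQForall P) + (1200 + A) := by
  have hδ := one_le_delta hd
  have h0 : (0 : ℝ) ≤ d := by positivity
  have hdd : (dmod : ℝ) ≤ delta d := by have := h.dmod_le; unfold delta; nlinarith
  have hdm : 20 * dmod ≤ delta d := by have := h.dmod_le; unfold delta; nlinarith
  exact Thm711.ineq713 (Real.mul_self_sqrt (logQAvoid_nonneg P ∅)) h.five_le_sqrt hδ hdm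
    (h.emod_le_dmod.trans hdd) (add_nonneg P.logDiff_nonneg P.logCond_nonneg)
    h.sqrt_le_ell h.ell_le h.thm611 h.eq712 hA

/-- **§7.1 as a kernel implication: the named inputs for `(Z, d)` give (7.1.11) "`h_{ω_{ℙ¹}(D)} ≤ (1+ε)·(log-diff_{ℙ¹}
+ log-con_D) + A_Z` holds on `Z ∩ U(Q̄)_{≤d}`", i.e. `VojtaIneq Z d ε`, for every `ε > 0`.** Prop 5.6.1 (`Cor22.PartI`)
supplies `A_Z` (p.73 l.75–79) and `h ≈ (1/6)Q` (p.75 l.11–12); off `Exc`: `PointInputs.ineq713` + `ineq719_uniform`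
= (7.1.9)–(7.1.10); on `Exc`: the printed height bound and `log-diff, log-con ≥ 0`; p.75 l.18 "By definitions
`log-diff(x_λ) = log(𝔡^{L_tpd})` …" = the tree's `NFPoint.logDiff/logCond`. PROVED. [folklore] -/
theorem Thm711Inputs.vojtaIneq {D : CBData} {d : ℕ} (I : Thm711Inputs D d) (hd : 0 < d) {ε : ℝ} (hε : 0 < ε) :
    VojtaIneq D.toSet d ε := by
  obtain ⟨⟨AZ, hAZ⟩, h23, h34⟩ := I.prop561 -- `A_Z` (p.73 l.75–79); then `h ≲ (1/6)Q` (p.75 l.11–12):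
  obtain ⟨C₀, hC₀⟩ := (h34.symm.trans h23.symm).bdLe
  obtain ⟨H, hH⟩ := I.ht_bdd_on_exc
  have hδ : 0 < delta d := lt_of_lt_of_le one_pos (one_le_delta hd)
  obtain ⟨A, hA⟩ := Thm711.ineq719_uniform hδ (by positivity : (0 : ℝ) < (15 * delta d) ^ 2) hε (1200 + AZ)
  refine ⟨|H| + |A| + |C₀|, fun P hP => ?_⟩
  have hLD : 0 ≤ P.logDiff + P.logCond := add_nonneg P.logDiff_nonneg P.logCond_nonneg
  have hεLD : 0 ≤ (1 + ε) * (P.logDiff + P.logCond) := mul_nonneg (by linarith) hLD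
  by_cases hPE : P ∈ I.Exc
  · linarith [hH P hPE, le_abs_self H, abs_nonneg A, abs_nonneg C₀]
  · obtain ⟨ℓ, dmod, emod, -, hPI⟩ := I.offExc P hP hPE
    have hAZP : 1 / 6 * logQForall P - 1 / 6 * logQNotTwo P ≤ AZ := by
      have := hAZ P hP.1; dsimp only at this
      rw [abs_sub_comm] at this; exact (le_abs_self _).trans this
    have h713 := hPI.ineq713 hd hAZP
    have h719 := hA (logQForall P) _ (logQAvoid_nonneg P ∅) hLD h713
    have hht := hC₀ P hP.1; dsimp only at hht
    linarith [le_abs_self A, le_abs_self C₀, abs_nonneg H]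

/-- **Thm 7.1.1 (reduced form) from its named inputs** (p.75 l.20, "This proves Theorem 7.1.1"): if for every `Z`
with (5.6.2) and every `d ≥ 1` the inputs of Thm 5.7.1 / Prop 5.6.1 / Lem 5.8.7 / Thm 6.1.1 as consumed in §7.1 are
available, then `Thm711Reduced`. PROVED (bookkeeping; the inputs are the disputed content). [folklore] -/
theorem thm711Reduced_of_inputs (h : ∀ D : CBData, Cor22.Hypotheses D → ∀ d : ℕ, 0 < d → Nonempty (Thm711Inputs D d)) :
    Thm711Reduced :=
  fun D hD d hd _ hε => (Classical.choice (h D hD d hd)).vojtaIneq hd hε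

/-- **§7.1 end to end for `(ℙ¹_ℚ, {0,1,∞})`**: inputs ⟹ Thm 7.1.1 reduced ⟹ `VojtaP1Deg d` for all `d ≥ 1`
(= the display of Thm 7.1.1 / [IUTchIV] Cor 2.3 at the tripod). PROVED as an implication. [folklore] -/
theorem vojtaP1Deg_of_inputs (h : ∀ D : CBData, Cor22.Hypotheses D → ∀ d : ℕ, 0 < d → Nonempty (Thm711Inputs D d))
    {d : ℕ} (hd : 0 < d) : VojtaP1Deg d :=
  vojtaP1Deg_of_thm711Reduced (thm711Reduced_of_inputs h) hd

/-! ## 5. §7.2 "From Theorem 7.1.1 one obtains Theorem 2.10.1. In particular: Theorem 7.2.1" — as kernel implications -/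

/-- **§7.2 / Thm 7.2.1, abc half, OUR form** (p.75 l.27–30: "From Theorem 7.1.1 one obtains Theorem 2.10.1. In
particular: Theorem 7.2.1. The abc-conjecture (Conjecture 2.1.1) and the arithmetic Szpiro conjecture over ℚ are
true."): `Thm711Reduced → ABC` (the summit statement; = Conj 2.1.1 up to T-24's ↔), via `d = 1` and the tree's abc
dictionary `GenEll.abc_of_vojtaP1Deg` (Prop 2.6.2). AN IMPLICATION ONLY from a disputed claim; NO abc claim. [folklore] -/
theorem abc_of_thm711Reduced (h : Thm711Reduced) : ABC :=
  abc_of_vojtaP1Deg fun _ hd => vojtaP1Deg_of_thm711Reduced h hd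

/-- **§7.2 / Thm 7.2.1, Szpiro half, OUR form**: `Thm711Reduced → SzpiroConjecture` (Szpiro over `ℚ`,
`Literature.NumberTheory.EllipticCurves.SzpiroConjecture`, = Conj 2.2.1 up to T-24's proved ↔), via abc ⟹ Szpiro
(tree theorem `szpiro_of_abcLe_holds`, Silverman VIII.11.5(b)). PROVED AS AN IMPLICATION ONLY. [folklore] -/
theorem szpiro_of_thm711Reduced (h : Thm711Reduced) : Literature.NumberTheory.EllipticCurves.SzpiroConjecture := by
  refine Literature.NumberTheory.EllipticCurves.szpiro_of_abcLe_holds fun ε hε => ?_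
  obtain ⟨C, -, hC⟩ := ABC_iff.mp (abc_of_thm711Reduced h) ε hε
  exact ⟨C, fun a b c habc => (hC a b c habc).le⟩

end Summit.ABC.IUTFork.Joshi.ATS4

end
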